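import Literature.MathematicalPhysics.QuantumLattice.HubbardTTPrimeCanonicalStatesGrandCanonicalEquilibrium
import HarnessLib

/-!
# Canonical thermal states of the 2D `t–t'` Hubbard model: tangent lines in `β`, energy antitone and entropy
# nondecreasing in the temperature — for ANY two torus limits (no common tori)

Topic `Literature/MathematicalPhysics/QuantumLattice` (family `hubbard`); corollaries of the master inequality of
`HubbardTTPrimeCanonicalStatesGrandCanonicalEquilibrium` (`p(β;n) + βe_Φ(ω) ≤ P(β₁;x₁) + β₁u_{x₁}(ω)` for every canonical
thermal torus-limit state `ω` at `(β; t,t',U; n)`) along the TEMPERATURE axis, for the thermal object of record of the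
`T > 0` certificate family (cell `hubbard-thermal`): torus limits of the canonical `(rectN n L, S^z = 0)`-sector Gibbs states,
`h : ω.IsTorusLimitOfMixture (sectorGibbsCount n) (sectorGibbsWeightTT' β t t' U n ·) (sectorGibbsVectorTT' t t' U n ·) Ls`,
`0 < n < 2`, `β > 0`, `U ≥ 0`, `p = pressureTT'`. PROVED:

* `…pressureTT'_add_le_pressureTT'_add_of_sectorGibbs` — **the canonical variational bound along the temperature axis**:
  `p(β;n) + β e_Φ(ω) ≤ p(β₁;n) + β₁ e_Φ(ω)` for every `β₁ > 0`, i.e. the TANGENT LINE `p(β₁) ≥ p(β) − (β₁ − β) e_Φ(ω)`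
  (`…pressureTT'_tangent_of_sectorGibbs`): a certified pressure floor at `β` and the energy of ANY thermal state at `β` transport
  the floor to every temperature (the thermal crew's chord/tangent device, here free of the «common sequence of tori» hypothesis).
* `…mul_sub_energy_sub_nonpos_of_sectorGibbs` — **the thermal energy is antitone in `β`** across ANY two canonical thermal
  torus-limit states `ω` at `β` and `ω₁` at `β₁` (same `t,t',U,n`; any two sequences of tori): `(β₁ − β)(e_Φ(ω₁) − e_Φ(ω)) ≤ 0`;
  hence certified thermal-energy FLOORS propagate to hotter temperatures and CAPS to colder ones
  (`…energy_le_of_sectorGibbs_of_le`, `…le_energy_of_cap_of_sectorGibbs`, `…floor_le_energy_of_sectorGibbs`).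
* `…entropyDensity_le_of_sectorGibbs` — **the entropy density `s(ω) = p(β;n) + βe_Φ(ω)`
  (`…EntropyDensityCanonical.tendsto_vonNeumannEntropy_rdm_div_sq_of_sectorGibbs`) is nonincreasing in `β`**:
  `β < β₁ ⇒ p(β₁;n) + β₁e_Φ(ω₁) ≤ p(β;n) + βe_Φ(ω)`; box-entropy form `…eventually_vonNeumannEntropy_rdm_div_sq_le_of_sectorGibbs_of_le`.

The grand-canonical twins are `HubbardTTPrimeGrandCanonicalThermalStatesMonotone` / `HubbardTTPrimeThermalStatesEntropyMonotone`.
Everything is PROVED; no definition, no named fact, no number.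

## Mathlib / tree search

REUSED: `IsTorusLimitOfMixture.pressureTT'_add_le_gcPressureTT'Zeeman_add_of_sectorGibbs` (master inequality),
`IsTorusLimitOfMixture.density_eq_of_sectorGibbs`, `exists_chemicalPotential_pressureTT'_eq`, `gcPressureTT'Zeeman_zero`,
`IsTorusLimitOfMixture.tendsto_vonNeumannEntropy_rdm_div_sq_of_sectorGibbs`. `lean search 'sectorGibbs.*antitone|entropy.*sectorGibbs.*mono'`
(2026-08-27): the tree's canonical antitonicity (`TorusSectorGibbsEnergyWindow`) is stated along a COMMON sequence of tori.

## References

* R. B. Israel, *Convexity in the Theory of Lattice Gases* (1979), Thm. I.2.4 (tangent functionals), Lemma II.3.1.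
  [cite: Israel1979, Thm. I.2.4]
* H. Araki, H. Moriya, Rev. Math. Phys. 15 (2003) 93, Thm. 3.8 and §10 (entropy, variational principle).
  [cite: ArakiMoriya2003, Theorem 3.8 and §10]
-/

noncomputable section

open scoped ComplexOrder BigOperators
open Finset Literature.InformationTheory.Entropy

namespace Literature.MathematicalPhysics.QuantumLattice

open Matrix HubbardWave0 Literature.Probability.LatticeModels ThermodynamicLimit
open _root_.Filter
open scoped _root_.Topology

namespace InfVolFermionState

variable (t t' : ℝ) {U : ℝ} (hU : 0 ≤ U) {β : ℝ} (hβ : 0 < β) {ω ω₁ : InfVolFermionState 2} {Ls Ls₁ : ℕ → ℕ} {n : ℝ}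
include hU hβ

/-- **The canonical variational bound along the temperature axis.** For a canonical thermal torus-limit state `ω` at
`(β; t,t',U; n)`, `0 < n < 2`, and every `β₁ > 0`: `p(β;n) + βe_Φ(ω) ≤ p(β₁;n) + β₁e_Φ(ω)` (the master inequality at the
parameter point `(β₁; t,t',U; μ₁, 0)` with `μ₁` supporting `p(β₁;·)` at `n`). [cite: Israel1979, Thm. I.2.4] -/
theorem IsTorusLimitOfMixture.pressureTT'_add_le_pressureTT'_add_of_sectorGibbs (hn0 : 0 < n) (hn2 : n < 2)
    (h : ω.IsTorusLimitOfMixture (sectorGibbsCount n) (fun L => sectorGibbsWeightTT' β t t' U n L)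
      (fun L => sectorGibbsVectorTT' t t' U n L) Ls)
    (hLs : Tendsto Ls atTop atTop) {β₁ : ℝ} (hβ₁ : 0 < β₁) :
    pressureTT' β t t' U n + β * ω.meanEnergy (hubbardTTPrimeFermionInteraction t t' U) 1 ≤
      pressureTT' β₁ t t' U n + β₁ * ω.meanEnergy (hubbardTTPrimeFermionInteraction t t' U) 1 := by
  obtain ⟨μ₁, hμ₁⟩ := exists_chemicalPotential_pressureTT'_eq hβ₁.le t t' hU hβ₁ hn0 hn2
  have hρ : ω.density = n := h.density_eq_of_sectorGibbs t t' U hn0.le hn2.le β hLs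
  have hm := h.pressureTT'_add_le_gcPressureTT'Zeeman_add_of_sectorGibbs t t' hU hβ hn0 hn2 hLs hβ₁.le t t' hU μ₁ 0
  rw [gcPressureTT'Zeeman_zero, hρ, zero_mul, sub_zero] at hm
  have e : gcPressureTT' β₁ t t' U μ₁ + β₁ * (ω.meanEnergy (hubbardTTPrimeFermionInteraction t t' U) 1 - μ₁ * n) =
      pressureTT' β₁ t t' U n + β₁ * ω.meanEnergy (hubbardTTPrimeFermionInteraction t t' U) 1 := by
    rw [hμ₁]; ring
  linarith [hm, e.le]

/-- **Tangent line in `β`**: `p(β₁;n) ≥ p(β;n) − (β₁ − β)·e_Φ(ω)` for every `β₁ > 0` — a pressure FLOOR at `β` plus an energy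
CAP of any canonical thermal state at `β` (for `β₁ > β`; a floor for `β₁ < β`) transports the floor along the temperature axis.
[cite: Israel1979, Thm. I.2.4] -/
theorem IsTorusLimitOfMixture.pressureTT'_tangent_of_sectorGibbs (hn0 : 0 < n) (hn2 : n < 2)
    (h : ω.IsTorusLimitOfMixture (sectorGibbsCount n) (fun L => sectorGibbsWeightTT' β t t' U n L)
      (fun L => sectorGibbsVectorTT' t t' U n L) Ls)
    (hLs : Tendsto Ls atTop atTop) {β₁ : ℝ} (hβ₁ : 0 < β₁) :
    pressureTT' β t t' U n - (β₁ - β) * ω.meanEnergy (hubbardTTPrimeFermionInteraction t t' U) 1 ≤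
      pressureTT' β₁ t t' U n := by
  have hm := h.pressureTT'_add_le_pressureTT'_add_of_sectorGibbs t t' hU hβ hn0 hn2 hLs hβ₁
  linarith

/-- **Certificate form of the tangent**: `W ≤ p(β;n)`, `e_Φ(ω) ≤ E` and `β ≤ β₁` give `W − (β₁ − β)E ≤ p(β₁;n)`.
[cite: Israel1979, Thm. I.2.4] -/
theorem IsTorusLimitOfMixture.floor_sub_mul_le_pressureTT'_of_sectorGibbs (hn0 : 0 < n) (hn2 : n < 2)
    (h : ω.IsTorusLimitOfMixture (sectorGibbsCount n) (fun L => sectorGibbsWeightTT' β t t' U n L)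
      (fun L => sectorGibbsVectorTT' t t' U n L) Ls)
    (hLs : Tendsto Ls atTop atTop) {β₁ W E : ℝ} (hββ₁ : β ≤ β₁) (hW : W ≤ pressureTT' β t t' U n)
    (hE : ω.meanEnergy (hubbardTTPrimeFermionInteraction t t' U) 1 ≤ E) :
    W - (β₁ - β) * E ≤ pressureTT' β₁ t t' U n := by
  have hβ₁ : 0 < β₁ := lt_of_lt_of_le hβ hββ₁
  have hm := h.pressureTT'_tangent_of_sectorGibbs t t' hU hβ hn0 hn2 hLs hβ₁
  nlinarith [mul_le_mul_of_nonneg_left hE (sub_nonneg.2 hββ₁)]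

omit hβ in
/-- **THE THERMAL ENERGY IS ANTITONE IN `β` — any two torus limits.** If `ω` is a canonical thermal torus-limit state at `β > 0`
and `ω₁` one at `β₁ > 0` (same `t, t', U, n`, possibly along different sequences of tori), then
`(β₁ − β)(e_Φ(ω₁) − e_Φ(ω)) ≤ 0`. [cite: Israel1979, Thm. I.2.4] -/
theorem IsTorusLimitOfMixture.mul_sub_energy_sub_nonpos_of_sectorGibbs (hn0 : 0 < n) (hn2 : n < 2) {β : ℝ} (hβ : 0 < β)
    (h : ω.IsTorusLimitOfMixture (sectorGibbsCount n) (fun L => sectorGibbsWeightTT' β t t' U n L)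
      (fun L => sectorGibbsVectorTT' t t' U n L) Ls)
    (hLs : Tendsto Ls atTop atTop) {β₁ : ℝ} (hβ₁ : 0 < β₁)
    (h₁ : ω₁.IsTorusLimitOfMixture (sectorGibbsCount n) (fun L => sectorGibbsWeightTT' β₁ t t' U n L)
      (fun L => sectorGibbsVectorTT' t t' U n L) Ls₁)
    (hLs₁ : Tendsto Ls₁ atTop atTop) :
    (β₁ - β) * (ω₁.meanEnergy (hubbardTTPrimeFermionInteraction t t' U) 1 -
      ω.meanEnergy (hubbardTTPrimeFermionInteraction t t' U) 1) ≤ 0 := by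
  have a := h.pressureTT'_add_le_pressureTT'_add_of_sectorGibbs t t' hU hβ hn0 hn2 hLs hβ₁
  have b := h₁.pressureTT'_add_le_pressureTT'_add_of_sectorGibbs t t' hU hβ₁ hn0 hn2 hLs₁ hβ
  nlinarith [a, b]

omit hβ in
/-- **Colder is lower**: `β ≤ β₁ ⇒ e_Φ(ω₁) ≤ e_Φ(ω)` for canonical thermal torus-limit states `ω` at `β`, `ω₁` at `β₁`.
[cite: Israel1979, Thm. I.2.4] -/
theorem IsTorusLimitOfMixture.energy_le_of_sectorGibbs_of_le (hn0 : 0 < n) (hn2 : n < 2) {β : ℝ} (hβ : 0 < β)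
    (h : ω.IsTorusLimitOfMixture (sectorGibbsCount n) (fun L => sectorGibbsWeightTT' β t t' U n L)
      (fun L => sectorGibbsVectorTT' t t' U n L) Ls)
    (hLs : Tendsto Ls atTop atTop) {β₁ : ℝ} (hββ₁ : β < β₁)
    (h₁ : ω₁.IsTorusLimitOfMixture (sectorGibbsCount n) (fun L => sectorGibbsWeightTT' β₁ t t' U n L)
      (fun L => sectorGibbsVectorTT' t t' U n L) Ls₁)
    (hLs₁ : Tendsto Ls₁ atTop atTop) :
    ω₁.meanEnergy (hubbardTTPrimeFermionInteraction t t' U) 1 ≤ ω.meanEnergy (hubbardTTPrimeFermionInteraction t t' U) 1 := by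
  have hβ₁ : 0 < β₁ := lt_trans hβ hββ₁
  have hm := h.mul_sub_energy_sub_nonpos_of_sectorGibbs t t' hU hn0 hn2 hβ hLs hβ₁ h₁ hLs₁
  have hpos : 0 < β₁ - β := sub_pos.2 hββ₁
  nlinarith

omit hβ in
/-- **A certified thermal-energy CAP at a hotter temperature is a cap at every colder one**: `e_Φ(ω) ≤ E` at `β` and
`β < β₁` give `e_Φ(ω₁) ≤ E` at `β₁`. [cite: Israel1979, Thm. I.2.4] -/
theorem IsTorusLimitOfMixture.le_energy_of_cap_of_sectorGibbs (hn0 : 0 < n) (hn2 : n < 2) {β : ℝ} (hβ : 0 < β)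
    (h : ω.IsTorusLimitOfMixture (sectorGibbsCount n) (fun L => sectorGibbsWeightTT' β t t' U n L)
      (fun L => sectorGibbsVectorTT' t t' U n L) Ls)
    (hLs : Tendsto Ls atTop atTop) {β₁ : ℝ} (hββ₁ : β < β₁)
    (h₁ : ω₁.IsTorusLimitOfMixture (sectorGibbsCount n) (fun L => sectorGibbsWeightTT' β₁ t t' U n L)
      (fun L => sectorGibbsVectorTT' t t' U n L) Ls₁)
    (hLs₁ : Tendsto Ls₁ atTop atTop) {E : ℝ} (hE : ω.meanEnergy (hubbardTTPrimeFermionInteraction t t' U) 1 ≤ E) :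
    ω₁.meanEnergy (hubbardTTPrimeFermionInteraction t t' U) 1 ≤ E :=
  (h.energy_le_of_sectorGibbs_of_le t t' hU hn0 hn2 hβ hLs hββ₁ h₁ hLs₁).trans hE

omit hβ in
/-- **A certified thermal-energy FLOOR at a colder temperature is a floor at every hotter one**: `F ≤ e_Φ(ω₁)` at `β₁`
and `β < β₁` give `F ≤ e_Φ(ω)` at `β`. [cite: Israel1979, Thm. I.2.4] -/
theorem IsTorusLimitOfMixture.floor_le_energy_of_sectorGibbs (hn0 : 0 < n) (hn2 : n < 2) {β : ℝ} (hβ : 0 < β)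
    (h : ω.IsTorusLimitOfMixture (sectorGibbsCount n) (fun L => sectorGibbsWeightTT' β t t' U n L)
      (fun L => sectorGibbsVectorTT' t t' U n L) Ls)
    (hLs : Tendsto Ls atTop atTop) {β₁ : ℝ} (hββ₁ : β < β₁)
    (h₁ : ω₁.IsTorusLimitOfMixture (sectorGibbsCount n) (fun L => sectorGibbsWeightTT' β₁ t t' U n L)
      (fun L => sectorGibbsVectorTT' t t' U n L) Ls₁)
    (hLs₁ : Tendsto Ls₁ atTop atTop) {F : ℝ} (hF : F ≤ ω₁.meanEnergy (hubbardTTPrimeFermionInteraction t t' U) 1) :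
    F ≤ ω.meanEnergy (hubbardTTPrimeFermionInteraction t t' U) 1 :=
  hF.trans (h.energy_le_of_sectorGibbs_of_le t t' hU hn0 hn2 hβ hLs hββ₁ h₁ hLs₁)

omit hβ in
/-- **THE ENTROPY DENSITY IS NONINCREASING IN `β` (nondecreasing in the temperature).** For canonical thermal torus-limit
states `ω` at `β` and `ω₁` at `β₁` with `0 < β < β₁` (same `t,t',U,n`): `p(β₁;n) + β₁e_Φ(ω₁) ≤ p(β;n) + βe_Φ(ω)` — these are
the entropy densities `lim S(·_{[0,ℓ)²})/ℓ²` of the two states. (At `β = β₁` two different torus limits may differ in energy and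
entropy — phase coexistence — so the strict inequality between the temperatures is needed.)
[cite: ArakiMoriya2003, Theorem 3.8 and §10] [cite: Israel1979, Thm. I.2.4] -/
theorem IsTorusLimitOfMixture.entropyDensity_le_of_sectorGibbs (hn0 : 0 < n) (hn2 : n < 2) {β : ℝ} (hβ : 0 < β)
    (h : ω.IsTorusLimitOfMixture (sectorGibbsCount n) (fun L => sectorGibbsWeightTT' β t t' U n L)
      (fun L => sectorGibbsVectorTT' t t' U n L) Ls)
    (hLs : Tendsto Ls atTop atTop) {β₁ : ℝ} (hββ₁ : β < β₁)
    (h₁ : ω₁.IsTorusLimitOfMixture (sectorGibbsCount n) (fun L => sectorGibbsWeightTT' β₁ t t' U n L)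
      (fun L => sectorGibbsVectorTT' t t' U n L) Ls₁)
    (hLs₁ : Tendsto Ls₁ atTop atTop) :
    pressureTT' β₁ t t' U n + β₁ * ω₁.meanEnergy (hubbardTTPrimeFermionInteraction t t' U) 1 ≤
      pressureTT' β t t' U n + β * ω.meanEnergy (hubbardTTPrimeFermionInteraction t t' U) 1 := by
  have hβ₁ : 0 < β₁ := lt_trans hβ hββ₁
  -- `s(ω₁) ≤ p(β) + β e(ω₁)` (variational bound for `ω₁` at `β`) and `e(ω₁) ≤ e(ω)` (antitone)
  have a := h₁.pressureTT'_add_le_pressureTT'_add_of_sectorGibbs t t' hU hβ₁ hn0 hn2 hLs₁ hβ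
  have he := h.energy_le_of_sectorGibbs_of_le t t' hU hn0 hn2 hβ hLs hββ₁ h₁ hLs₁
  nlinarith [a, mul_le_mul_of_nonneg_left he hβ.le]

omit hβ in
/-- **Box-entropy form**: for `0 < β < β₁` and every `ε > 0`, eventually in `ℓ`,
`S(ω₁,[0,ℓ)²)/ℓ² ≤ S(ω,[0,ℓ)²)/ℓ² + ε` — colder canonical thermal states have no more entropy per site.
[cite: ArakiMoriya2003, Theorem 3.8 and §10] -/
theorem IsTorusLimitOfMixture.eventually_vonNeumannEntropy_rdm_div_sq_le_of_sectorGibbs_of_le (hn0 : 0 < n) (hn2 : n < 2)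
    {β : ℝ} (hβ : 0 < β)
    (h : ω.IsTorusLimitOfMixture (sectorGibbsCount n) (fun L => sectorGibbsWeightTT' β t t' U n L)
      (fun L => sectorGibbsVectorTT' t t' U n L) Ls)
    (hLs : Tendsto Ls atTop atTop) {β₁ : ℝ} (hββ₁ : β < β₁)
    (h₁ : ω₁.IsTorusLimitOfMixture (sectorGibbsCount n) (fun L => sectorGibbsWeightTT' β₁ t t' U n L)
      (fun L => sectorGibbsVectorTT' t t' U n L) Ls₁)
    (hLs₁ : Tendsto Ls₁ atTop atTop) {ε : ℝ} (hε : 0 < ε) :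
    ∀ᶠ ℓ : ℕ in atTop, vonNeumannEntropy (ω₁.rdm (halfOpenBox 2 ℓ)) / (ℓ : ℝ) ^ 2 ≤
      vonNeumannEntropy (ω.rdm (halfOpenBox 2 ℓ)) / (ℓ : ℝ) ^ 2 + ε := by
  have hβ₁ : 0 < β₁ := lt_trans hβ hββ₁
  have hs := h.tendsto_vonNeumannEntropy_rdm_div_sq_of_sectorGibbs t t' hU hβ hn0 hn2 hLs
  have hs₁ := h₁.tendsto_vonNeumannEntropy_rdm_div_sq_of_sectorGibbs t t' hU hβ₁ hn0 hn2 hLs₁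
  have hle := h.entropyDensity_le_of_sectorGibbs t t' hU hn0 hn2 hβ hLs hββ₁ h₁ hLs₁
  set s := pressureTT' β t t' U n + β * ω.meanEnergy (hubbardTTPrimeFermionInteraction t t' U) 1
  set s₁ := pressureTT' β₁ t t' U n + β₁ * ω₁.meanEnergy (hubbardTTPrimeFermionInteraction t t' U) 1
  have h2 : (0 : ℝ) < ε / 2 := by linarith
  filter_upwards [(tendsto_order.1 hs).1 (s - ε / 2) (by linarith), (tendsto_order.1 hs₁).2 (s₁ + ε / 2) (by linarith)]
    with ℓ ha hb
  linarith

end InfVolFermionState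

end Literature.MathematicalPhysics.QuantumLattice

end
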